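import Summits.Ventures.YMGap.RobustBall.TorusOneLink
import Summits.Ventures.YMGap.RobustBall.LimitStateClustering
import Summits.Ventures.YMGap.RobustBall.UniformPlaquetteSusceptibility
import Summits.Ventures.YMGap.Thresholds.StateLipschitzRows
import Summits.Ventures.YMGap.Thresholds.RegionBoundaryTiltLipschitz
import Summits.Ventures.YMGap.Thresholds.TorusStateResponse
import Literature.MathematicalPhysics.QuantumFieldTheory.QuasiLocalGaugePerturbationKernels
import Literature.MathematicalPhysics.QuantumLattice.WilsonFeynmanHellmann
import Literature.Probability.LatticeModels.ForbiddenGapFirstOrder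
import HarnessLib

/-!
# Venture YMGap, track ROBUST-BALL (Y2) — C-LIP ON THE TORUS BALL: inside the robust door the torus state of EVERY member is Lipschitz in
# the coupling on local Lipschitz observables, uniformly in the volume and in the member

HONEST FRAMING. WHAT THIS IS: a venture file (cell `pub-ymgap`, track Y2 ROBUST-BALL, seat rb-p2, theorems only, 0 compute).  Finite-volume
(torus) LATTICE statements for the members `W` of rb-theory's torus ball (`Perturbation d L N`, `G = SU(N)`) INSIDE the robust door, i.e. under
ds-2's clustering currency `ClustersWith W t A m` at every coupling of a segment (hypothesis-free on the certified cells via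
`TorusClusteringOnBallUpTo`):
* ★ `hasDerivAt_memberExpectation` — FEYNMAN–HELLMANN FOR MEMBERS: for every bounded measurable `F` and every real `t`,
  `d/dt ∫ F dμ_{Λ,t,W} = −Cov_{μ_{Λ,t,W}}(F, S_W)` (lit's `hasDerivAt_integral_tilted_eq_covariance` for the a-priori law `ν_W ∝ e^{−W}∏dU`,
  `perturbedMeasure_eq_tilted` + Mathlib `tilted_tilted`).
* ★ `abs_cov_wilsonAction_le_of_clustersWith` — for a local observable `F` (links `Δ` based within torus distance `D` of a site `x₀`, `suFrobDist`-Lipschitz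
  vector `δ`, bounded measurable): `|Cov_{μ_{Λ,t,W}}(F, S_W)| ≤ A · 4√N · (Σ_Δ δ) · e^{m(D+1)} · #orient · ((1+e^{−m/d})/(1−e^{−m/d}))^d` — uniformly in `L`
  (plaquettes as transported Lipschitz cylinders + the torus lattice sum of `TorusEnergyVarianceCeilingBall`, re-derived inline so that this
  file depends only on long-built modules).
* ★★ `abs_memberExpectation_sub_le` — C-LIP ON THE TORUS BALL: if `ClustersWith W t A m` for all `t ∈ [lo, hi]`, then for `s, t ∈ [lo, hi]`,
  `|⟨F⟩_{Λ,t,W} − ⟨F⟩_{Λ,s,W}| ≤ K_F |t − s|` with the SAME `K_F` for every volume and every member with these clustering constants;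
  `abs_memberExpectation_sub_le_onBallUpTo` — from `TorusClusteringOnBallUpTo N d βs ε₀ ε₁ r A m` on `[0, βs]`, every member, every `L ≥ 3`.
Companion of ds-1's infinite-volume C-LIP for `ℤ^d` members inside the ONE-LINK door (`StateLipschitzMember`, Dobrushin comparison); here any door that
yields the torus clustering currency (e.g. the variance-form star door of the lead cell `(1/8, 0.223)`) suffices, in finite volume uniformly in `L`.
WHAT THIS IS NOT: no infinite-volume statement; constants are Dobrushin artefacts; nothing about the continuum limit or a Clay-sense mass gap.

References: B. Simon, *The Statistical Mechanics of Lattice Gases* I (1993), §II.1, §II.12; the tree's `WilsonFeynmanHellmann.lean`,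
`Defs.lean` (`ClustersWith`), `TorusEnergyVarianceCeilingBall.lean`.  Everything here is proved; no definition, no named fact. [folklore]
-/

noncomputable section

open MeasureTheory ProbabilityTheory Finset Function Filter Topology
open Literature.Probability.LatticeModels (Torus.proj Torus.proj_apply)
open Literature.Probability.LatticeModels.DobrushinMetric
open Summit.Ventures.YMGap.CouplingResponse (exists_centredLift plaquetteObs_torusLift)
open Literature.MathematicalPhysics.QuantumLattice hiding torusNorm
open Literature.MathematicalPhysics.QuantumFieldTheory hiding ZdEdge Site

namespace Summit.Ventures.YMGap.RobustBall

namespace EnergyVariance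

variable {d L N : ℕ} [NeZero L]

/-! ### Feynman–Hellmann for members -/

/-- ★ **FEYNMAN–HELLMANN FOR A MEMBER OF THE TORUS BALL**: for every bounded measurable observable `F` and every real `t`,
`d/dt ∫ F dμ_{Λ,t,W} = Cov_{μ_{Λ,t,W}}(F, −S_W)`. [folklore] -/
theorem hasDerivAt_memberExpectation (W : Perturbation d L N) {F : GaugeConfig d L (SUN N) → ℝ} (hFm : Measurable F) {C : ℝ}
    (hC : ∀ U, |F U| ≤ C) (t : ℝ) :
    HasDerivAt (fun s : ℝ => ∫ U, F U ∂W.perturbedMeasure (fundamentalRep (Fin N)) s)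
      (cov[F, fun U => -wilsonAction (fundamentalRep (Fin N)) U; W.perturbedMeasure (fundamentalRep (Fin N)) t]) t := by
  haveI : SecondCountableTopology (Matrix (Fin N) (Fin N) ℂ) :=
    inferInstanceAs (SecondCountableTopology (Fin N → Fin N → ℂ))
  haveI : SecondCountableTopology (SUN N) := Topology.IsEmbedding.subtypeVal.secondCountableTopology
  have hρc : Continuous (fundamentalRep (Fin N) : SUN N →* Matrix (Fin N) (Fin N) ℂ) := continuous_fundamentalRep (Fin N)
  -- the a-priori law `ν_W ∝ e^{−W} ∏ dU` (probability) and the energy `X = −S_W`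
  have hexpW : Integrable (fun U : GaugeConfig d L (SUN N) => Real.exp (-W.total U))
      (Measure.pi fun _ : Edge d L => haarProbability (SUN N)) := by
    obtain ⟨C', hC'⟩ := W.exists_abs_total_le
    exact Literature.Probability.LatticeModels.integrable_exp_of_abs_le _ W.measurable_total.neg
      ⟨C', fun U => by rw [abs_neg]; exact hC' U⟩
  set ν : Measure (GaugeConfig d L (SUN N)) :=
    (Measure.pi fun _ : Edge d L => haarProbability (SUN N)).tilted fun U => -W.total U with hν
  haveI : IsProbabilityMeasure ν := isProbabilityMeasure_tilted hexpW
  set X : GaugeConfig d L (SUN N) → ℝ := fun U => -wilsonAction (fundamentalRep (Fin N)) U with hX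
  have hXm : Measurable X := (measurable_wilsonAction _ hρc).neg
  obtain ⟨B, hB⟩ := exists_abs_wilsonAction_le (d := d) (L := L) (fundamentalRep (Fin N) : SUN N →* Matrix (Fin N) (Fin N) ℂ) hρc
  have hXb : ∀ U, |X U| ≤ B := fun U => by rw [hX, abs_neg]; exact hB U
  have hint : t ∈ interior (integrableExpSet X ν) := by
    have hI : integrableExpSet X ν = Set.univ :=
      Set.eq_univ_of_forall fun s => Literature.Probability.LatticeModels.ForbiddenGap.integrable_exp_mul_of_abs_le hXm hXb s
    rw [hI, interior_univ]
    exact Set.mem_univ _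
  have h := hasDerivAt_integral_tilted_eq_covariance (μ := ν) hint hFm.aestronglyMeasurable (C := C)
    (ae_of_all _ fun U => by rw [Real.norm_eq_abs]; exact hC U)
  -- `ν_W` tilted by `s·X` is the member's torus state at coupling `s` (lit's `perturbedMeasure_eq_tilted`)
  have e : ∀ s : ℝ, ν.tilted (fun U => s * X U) = W.perturbedMeasure (fundamentalRep (Fin N)) s := by
    intro s
    rw [hν, tilted_tilted hexpW, QuasiLocalGaugePerturbation.perturbedMeasure_eq_tilted (fundamentalRep (Fin N)) hρc s W]
    congr 1
    funext U
    simp only [Pi.add_apply, hX]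
    ring
  simp only [e] at h
  exact h

/-! ### The response `Cov(F, S_W)` is bounded uniformly in the volume inside the door -/

omit [NeZero L] in
/-- Links of a plaquette project to torus sites within distance `1` of the projected base point. [folklore] -/
theorem torusNorm_proj_sub_torusEdge_le_one {p : ZdPlaquette d} {e : Literature.MathematicalPhysics.QuantumFieldTheory.ZdEdge d}
    (he : e ∈ plaquetteEdges p) :
    torusNorm ((Torus.proj L p.1 : Literature.MathematicalPhysics.QuantumFieldTheory.Site d L) - (torusEdge L e).1) ≤ 1 := by
  have h0 : (p.1, p.2.1.1) ∈ plaquetteEdges p := by simp [plaquetteEdges]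
  have h1 := norm_sub_le_one_of_mem_plaquetteEdges h0 he
  rw [Literature.Probability.LatticeModels.Site.norm_eq_supNorm] at h1
  have h2 : Literature.Probability.LatticeModels.Site.supNorm (p.1 - e.1) ≤ 1 := by exact_mod_cast h1
  have h3 : (Torus.proj L p.1 : Literature.MathematicalPhysics.QuantumFieldTheory.Site d L) - (torusEdge L e).1 =
      Torus.proj L (p.1 - e.1) := by
    funext i; simp [torusEdge, Torus.proj, Int.cast_sub]
  rw [h3]
  exact (torusNorm_proj_le _).trans h2

/-- ★ **One plaquette**: `ClustersWith W t A m` (`A ≥ 0`, `m ≥ 0`) and a local observable `F` (links `Δ`, all based within torus distance `D` of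
`x₀`, Lipschitz vector `δ`, bounded measurable) give `|Cov_{μ_{Λ,t,W}}(F, Re tr U_q)| ≤ A · 4√N · (Σ_Δ δ) · e^{m(D+1)} · e^{−m‖x₀ − q‖_T}`. [folklore] -/
theorem abs_cov_plaquetteObs_le_of_clustersWith {W : Perturbation d L N} {t A m : ℝ} (hW : ClustersWith W t A m) (hA : 0 ≤ A)
    (hm : 0 ≤ m) {F : GaugeConfig d L (SUN N) → ℝ} (hFm : Measurable F) {Δ : Finset (Edge d L)}
    (hFdep : DependsOn F (↑Δ : Set (Edge d L))) (hFb : ∃ M, ∀ U, |F U| ≤ M) {δ : Edge d L → ℝ} (hFlip : IsLipBound suFrobDist F δ)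
    {x₀ : Literature.MathematicalPhysics.QuantumFieldTheory.Site d L} {D : ℕ} (hD : ∀ x ∈ Δ, torusNorm (x.1 - x₀) ≤ D)
    (q : Plaquette d L) :
    |cov[F, fun U : GaugeConfig d L (SUN N) => ((fundamentalRep (Fin N)) (plaquetteHolonomy U q.1 q.2.1.1 q.2.1.2)).trace.re;
        W.perturbedMeasure (fundamentalRep (Fin N)) t]| ≤
      A * (4 * Real.sqrt N) * (∑ x ∈ Δ, δ x) * Real.exp (m * (D + 1)) * Real.exp (-m * (torusNorm (x₀ - q.1) : ℝ)) := by
  classical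
  haveI : SecondCountableTopology (Matrix (Fin N) (Fin N) ℂ) :=
    inferInstanceAs (SecondCountableTopology (Fin N → Fin N → ℂ))
  haveI : SecondCountableTopology (SUN N) := Topology.IsEmbedding.subtypeVal.secondCountableTopology
  have hρc : Continuous (fundamentalRep (Fin N) : SUN N →* Matrix (Fin N) (Fin N) ℂ) := continuous_fundamentalRep (Fin N)
  set qz : ZdPlaquette d := ((fun i => ((q.1 i).val : ℤ)), q.2) with hqz
  have hqproj : (Torus.proj L qz.1 : Literature.MathematicalPhysics.QuantumFieldTheory.Site d L) = q.1 := by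
    funext i; simp [hqz, Torus.proj_apply]
  -- the torus plaquette observable is the torus restriction of the `ℤ^d` one at the integer lift
  have hPq : (fun U : GaugeConfig d L (SUN N) => ((fundamentalRep (Fin N)) (plaquetteHolonomy U q.1 q.2.1.1 q.2.1.2)).trace.re) =
      toTorusObservable L (plaquetteObs (fundamentalRep (Fin N)) qz.1 qz.2.1.1 qz.2.1.2) := by
    funext U
    rw [toTorusObservable_apply, plaquetteObs_torusLift, hqproj]
  rw [hPq]
  set n : ℕ := torusNorm (x₀ - q.1) - (D + 1) with hn
  have key := hW F (toTorusObservable L (plaquetteObs (fundamentalRep (Fin N)) qz.1 qz.2.1.1 qz.2.1.2)) Δ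
    ((plaquetteEdges qz).image (torusEdge L)) δ
    (fun eb => ∑ x ∈ (plaquetteEdges qz).filter (fun x => torusEdge L x = eb), (if x ∈ plaquetteEdges qz then Real.sqrt N else 0))
    n hFm ((measurable_plaquetteObs (fundamentalRep (Fin N)) hρc qz.1 qz.2.1.1 qz.2.1.2).comp (measurable_torusLift L))
    hFdep (dependsOn_toTorusObservable L (isCylinder_plaquetteObs (fundamentalRep (Fin N)) qz))
    hFb ⟨N, fun U => LatticeBakryEmery.abs_plaquetteObs_le_N qz (torusLift L U)⟩ hFlip
    (isLipBound_toTorusObservable L suFrobDist_self (isCylinder_plaquetteObs (fundamentalRep (Fin N)) qz)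
      (StateLipschitzRows.isLipBound_plaquetteObs qz))
    (fun x hx eb heb => by
      obtain ⟨e, he, rfl⟩ := Finset.mem_image.1 heb
      have h1 := torusNorm_proj_sub_torusEdge_le_one (L := L) he
      rw [hqproj] at h1
      have h2 := hD x hx
      -- `‖x₀ − q‖ ≤ ‖x₀ − x‖ + ‖x − ē‖ + ‖ē − q‖`
      have t1 := torusNorm_sub_le x₀ x.1 q.1
      have t2 := torusNorm_sub_le x.1 (torusEdge L e).1 q.1
      have h2' : torusNorm (x₀ - x.1) ≤ D := by rw [← torusNorm_neg, neg_sub]; exact h2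
      have h1' : torusNorm ((torusEdge L e).1 - q.1) ≤ 1 := by rw [← torusNorm_neg, neg_sub]; exact h1
      rw [hn]; omega)
  rw [sum_image_fibre_eq] at key
  have hsum : ∑ x ∈ plaquetteEdges qz, (if x ∈ plaquetteEdges qz then Real.sqrt N else 0) ≤ 4 * Real.sqrt N := by
    rw [Finset.sum_ite_of_true (fun x hx => hx), Finset.sum_const, nsmul_eq_mul]
    exact mul_le_mul_of_nonneg_right (by exact_mod_cast card_plaquetteEdges_le qz) (Real.sqrt_nonneg _)
  have hδ0 : 0 ≤ ∑ x ∈ Δ, δ x := Finset.sum_nonneg fun x _ => hFlip.nonneg x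
  have hexp : Real.exp (-m * n) ≤ Real.exp (m * (D + 1)) * Real.exp (-m * (torusNorm (x₀ - q.1) : ℝ)) := by
    rw [← Real.exp_add]
    refine Real.exp_le_exp.2 ?_
    have h2 : ((torusNorm (x₀ - q.1) : ℕ) : ℝ) ≤ (n : ℝ) + (D + 1) := by
      have : torusNorm (x₀ - q.1) ≤ n + (D + 1) := by rw [hn]; omega
      exact_mod_cast this
    nlinarith
  calc |cov[F, toTorusObservable L (plaquetteObs (fundamentalRep (Fin N)) qz.1 qz.2.1.1 qz.2.1.2);
          W.perturbedMeasure (fundamentalRep (Fin N)) t]|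
      ≤ A * (∑ x ∈ plaquetteEdges qz, (if x ∈ plaquetteEdges qz then Real.sqrt N else 0)) * (∑ x ∈ Δ, δ x) * Real.exp (-m * n) := key
    _ ≤ A * (4 * Real.sqrt N) * (∑ x ∈ Δ, δ x) * (Real.exp (m * (D + 1)) * Real.exp (-m * (torusNorm (x₀ - q.1) : ℝ))) := by
        have hA4 : 0 ≤ A * (4 * Real.sqrt N) * ∑ x ∈ Δ, δ x := by positivity
        refine mul_le_mul ?_ hexp (Real.exp_pos _).le hA4
        exact mul_le_mul_of_nonneg_right (mul_le_mul_of_nonneg_left hsum hA) hδ0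
    _ = A * (4 * Real.sqrt N) * (∑ x ∈ Δ, δ x) * Real.exp (m * (D + 1)) * Real.exp (-m * (torusNorm (x₀ - q.1) : ℝ)) := by ring

/-- ★ **The total response `Cov(F, S_W)` is bounded uniformly in the volume**: `ClustersWith W t A m` (`A ≥ 0`, `m > 0`, `d ≥ 1`) ⇒
`|Cov_{μ_{Λ,t,W}}(F, S_W)| ≤ A · 4√N · (Σ_Δ δ) · e^{m(D+1)} · #orient · ((1+e^{−m/d})/(1−e^{−m/d}))^d`. [folklore] -/
theorem abs_cov_wilsonAction_le_of_clustersWith (hd : 1 ≤ d) {W : Perturbation d L N} {t A m : ℝ} (hW : ClustersWith W t A m)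
    (hA : 0 ≤ A) (hm : 0 < m) {F : GaugeConfig d L (SUN N) → ℝ} (hFm : Measurable F) {Δ : Finset (Edge d L)}
    (hFdep : DependsOn F (↑Δ : Set (Edge d L))) {M : ℝ} (hFb : ∀ U, |F U| ≤ M) {δ : Edge d L → ℝ} (hFlip : IsLipBound suFrobDist F δ)
    {x₀ : Literature.MathematicalPhysics.QuantumFieldTheory.Site d L} {D : ℕ} (hD : ∀ x ∈ Δ, torusNorm (x.1 - x₀) ≤ D) :
    |cov[F, wilsonAction (d := d) (L := L) (G := SUN N) (fundamentalRep (Fin N)); W.perturbedMeasure (fundamentalRep (Fin N)) t]| ≤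
      A * (4 * Real.sqrt N) * (∑ x ∈ Δ, δ x) * Real.exp (m * (D + 1)) *
        ((Fintype.card {ij : Fin d × Fin d // ij.1 < ij.2} : ℝ) * ((1 + Real.exp (-(m / d))) / (1 - Real.exp (-(m / d)))) ^ d) := by
  classical
  haveI : SecondCountableTopology (Matrix (Fin N) (Fin N) ℂ) :=
    inferInstanceAs (SecondCountableTopology (Fin N → Fin N → ℂ))
  haveI : SecondCountableTopology (SUN N) := Topology.IsEmbedding.subtypeVal.secondCountableTopology
  haveI : IsProbabilityMeasure (W.perturbedMeasure (fundamentalRep (Fin N)) t) := isProbabilityMeasure_perturbedMeasure W t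
  set μ := W.perturbedMeasure (fundamentalRep (Fin N)) t with hμ
  set P : Plaquette d L → GaugeConfig d L (SUN N) → ℝ := fun q U =>
    ((fundamentalRep (Fin N)) (plaquetteHolonomy U q.1 q.2.1.1 q.2.1.2)).trace.re with hP
  set K : ℝ := A * (4 * Real.sqrt N) * (∑ x ∈ Δ, δ x) * Real.exp (m * (D + 1)) with hK
  have hρc : Continuous (fundamentalRep (Fin N) : SUN N →* Matrix (Fin N) (Fin N) ℂ) := continuous_fundamentalRep (Fin N)
  -- `S_W = N·#plaquettes − Σ_q P_q`, so `Cov(F, S_W) = −Σ_q Cov(F, P_q)`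
  have hPeq : ∀ q : Plaquette d L, P q = toTorusObservable L
      (plaquetteObs (fundamentalRep (Fin N)) (fun i => ((q.1 i).val : ℤ)) q.2.1.1 q.2.1.2) := by
    intro q
    funext U
    have hproj : (Torus.proj L (fun i => ((q.1 i).val : ℤ)) : Literature.MathematicalPhysics.QuantumFieldTheory.Site d L) = q.1 := by
      funext i; simp [Torus.proj_apply]
    simp only [hP]
    rw [toTorusObservable_apply, plaquetteObs_torusLift, hproj]
  have hPm : ∀ q : Plaquette d L, Measurable (P q) := fun q => by
    rw [hPeq q]
    exact (measurable_plaquetteObs _ hρc _ _ _).comp (measurable_torusLift L)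
  have hPb : ∀ (q : Plaquette d L) (U : GaugeConfig d L (SUN N)), |P q U| ≤ N := fun q U => by
    have h := LatticeBakryEmery.abs_plaquetteObs_le_N ((fun i => ((q.1 i).val : ℤ), q.2) : ZdPlaquette d) (torusLift L U)
    have e := congrFun (hPeq q) U
    simp only [toTorusObservable_apply] at e
    rw [e]
    simpa using h
  have hPL2 : ∀ q : Plaquette d L, MemLp (P q) 2 μ := fun q =>
    memLp_of_bounded (a := -(N : ℝ)) (b := N) (ae_of_all _ fun U => abs_le.1 (hPb q U)) (hPm q).aestronglyMeasurable 2
  have hFL2 : MemLp F 2 μ := memLp_of_bounded (a := -M) (b := M) (ae_of_all _ fun U => abs_le.1 (hFb U)) hFm.aestronglyMeasurable 2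
  have hS : wilsonAction (d := d) (L := L) (G := SUN N) (fundamentalRep (Fin N)) =
      fun U => (N : ℝ) * (Fintype.card (Plaquette d L) : ℝ) - ∑ q : Plaquette d L, P q U := by
    funext U
    simp only [hP]
    unfold wilsonAction
    rw [Finset.sum_sub_distrib, Finset.sum_const, Finset.card_univ, nsmul_eq_mul]
    ring
  have hcov : cov[F, wilsonAction (d := d) (L := L) (G := SUN N) (fundamentalRep (Fin N)); μ] = -∑ q : Plaquette d L, cov[F, P q; μ] := by
    rw [hS]
    have hint : Integrable (fun U => ∑ q : Plaquette d L, P q U) μ :=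
      (memLp_finsetSum' Finset.univ fun q _ => hPL2 q).integrable one_le_two |>.congr
        (ae_of_all _ fun U => by simp)
    rw [covariance_const_sub_right hint, covariance_fun_sum_right hPL2 hFL2]
  rw [hcov, abs_neg]
  calc |∑ q : Plaquette d L, cov[F, P q; μ]| ≤ ∑ q : Plaquette d L, |cov[F, P q; μ]| := Finset.abs_sum_le_sum_abs _ _
    _ ≤ ∑ q : Plaquette d L, K * Real.exp (-m * (torusNorm (x₀ - q.1) : ℝ)) :=
        Finset.sum_le_sum fun q _ => abs_cov_plaquetteObs_le_of_clustersWith hW hA hm.le hFm hFdep ⟨M, hFb⟩ hFlip hD q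
    _ = ∑ y : Literature.MathematicalPhysics.QuantumFieldTheory.Site d L, ∑ _o : {ij : Fin d × Fin d // ij.1 < ij.2},
          K * Real.exp (-m * (torusNorm (y - x₀) : ℝ)) := by
        rw [← Finset.univ_product_univ, Finset.sum_product]
        refine Finset.sum_congr rfl fun y _ => Finset.sum_congr rfl fun o _ => ?_
        rw [← torusNorm_neg, neg_sub]
    _ = K * (Fintype.card {ij : Fin d × Fin d // ij.1 < ij.2} : ℝ) *
          ∑ y : Literature.MathematicalPhysics.QuantumFieldTheory.Site d L, Real.exp (-m * (torusNorm (y - x₀) : ℝ)) := by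
        rw [Finset.mul_sum]
        refine Finset.sum_congr rfl fun y _ => ?_
        rw [Finset.sum_const, Finset.card_univ, nsmul_eq_mul]
        ring
    _ ≤ K * (Fintype.card {ij : Fin d × Fin d // ij.1 < ij.2} : ℝ) * ((1 + Real.exp (-(m / d))) / (1 - Real.exp (-(m / d)))) ^ d := by
        have hK0 : 0 ≤ K := by
          have hδ0 : 0 ≤ ∑ x ∈ Δ, δ x := Finset.sum_nonneg fun x _ => hFlip.nonneg x
          positivity
        -- the torus lattice sum `Σ_y e^{−m‖y − x₀‖_T} ≤ Θ` (centred lift to `ℤ^d` + rb-p1's `ℓ¹` geometric sum), as in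
        -- `TorusEnergyVarianceCeilingBall.sum_exp_neg_mul_torusNorm_le`
        have hΘ : ∑ y : Literature.MathematicalPhysics.QuantumFieldTheory.Site d L, Real.exp (-m * (torusNorm (y - x₀) : ℝ)) ≤
            ((1 + Real.exp (-(m / d))) / (1 - Real.exp (-(m / d)))) ^ d := by
          classical
          set z₀ : Literature.Probability.LatticeModels.Site d := fun i => ((x₀ i).val : ℤ) with hz₀
          have hx : Torus.proj L z₀ = x₀ := by funext i; simp [hz₀, Torus.proj_apply]
          obtain ⟨s, hs, hcen, -⟩ := exists_centredLift L z₀ (d := d)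
          set r : ℝ := Real.exp (-(m / d)) with hr
          have hr0 : 0 ≤ r := (Real.exp_pos _).le
          have hd0 : (0 : ℝ) < d := by exact_mod_cast hd
          have hr1 : r < 1 := Real.exp_lt_one_iff.2 (by rw [neg_lt_zero]; exact div_pos hm hd0)
          have hsinj : Function.Injective s := fun y y' h => by rw [← hs y, ← hs y', h]
          calc ∑ y : Literature.MathematicalPhysics.QuantumFieldTheory.Site d L, Real.exp (-m * (torusNorm (y - x₀) : ℝ))
              = ∑ y : Literature.MathematicalPhysics.QuantumFieldTheory.Site d L, Real.exp (-m * ‖s y - z₀‖) := by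
                refine Finset.sum_congr rfl fun y _ => ?_
                rw [← hx, hcen y, Literature.Probability.LatticeModels.Site.norm_eq_supNorm]
            _ ≤ ∑ y : Literature.MathematicalPhysics.QuantumFieldTheory.Site d L, r ^ l1 (s y - z₀) :=
                Finset.sum_le_sum fun y _ => exp_neg_norm_le_pow hd hm.le (s y - z₀)
            _ = ∑ z ∈ (Finset.univ : Finset (Literature.MathematicalPhysics.QuantumFieldTheory.Site d L)).image s, r ^ l1 (z - z₀) := by
                rw [Finset.sum_image fun y _ y' _ h => hsinj h]
            _ = ∑ z ∈ (Finset.univ : Finset (Literature.MathematicalPhysics.QuantumFieldTheory.Site d L)).image s, r ^ l1 (z₀ - z) := by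
                refine Finset.sum_congr rfl fun z _ => ?_
                rw [l1_sub_comm]
            _ ≤ ((1 + r) / (1 - r)) ^ d := sum_pow_l1_sub_le hr0 hr1 z₀ _
        exact mul_le_mul_of_nonneg_left hΘ (by positivity)
    _ = K * ((Fintype.card {ij : Fin d × Fin d // ij.1 < ij.2} : ℝ) * ((1 + Real.exp (-(m / d))) / (1 - Real.exp (-(m / d)))) ^ d) := by
        ring

/-! ### C-LIP on the torus ball -/

/-- ★★ **C-LIP ON THE TORUS BALL, uniformly in the volume and in the member.**  If `W` clusters with `(A, m)` (`A ≥ 0`, `m > 0`, `d ≥ 1`) at every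
coupling of `[lo, hi]`, then for every local observable `F` (links `Δ` based within torus distance `D` of `x₀`, Lipschitz vector `δ`, `|F| ≤ M`)
and all `s, t ∈ [lo, hi]`: `|⟨F⟩_{Λ,t,W} − ⟨F⟩_{Λ,s,W}| ≤ (A · 4√N · (Σ_Δ δ) · e^{m(D+1)} · #orient · ((1+e^{−m/d})/(1−e^{−m/d}))^d) · |t − s|`. [folklore] -/
theorem abs_memberExpectation_sub_le (hd : 1 ≤ d) {W : Perturbation d L N} {A m lo hi : ℝ} (hA : 0 ≤ A) (hm : 0 < m)
    (hW : ∀ t ∈ Set.Icc lo hi, ClustersWith W t A m) {F : GaugeConfig d L (SUN N) → ℝ} (hFm : Measurable F)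
    {Δ : Finset (Edge d L)} (hFdep : DependsOn F (↑Δ : Set (Edge d L))) {M : ℝ} (hFb : ∀ U, |F U| ≤ M) {δ : Edge d L → ℝ}
    (hFlip : IsLipBound suFrobDist F δ) {x₀ : Literature.MathematicalPhysics.QuantumFieldTheory.Site d L} {D : ℕ}
    (hD : ∀ x ∈ Δ, torusNorm (x.1 - x₀) ≤ D) {s t : ℝ} (hs : s ∈ Set.Icc lo hi) (ht : t ∈ Set.Icc lo hi) :
    |∫ U, F U ∂W.perturbedMeasure (fundamentalRep (Fin N)) t - ∫ U, F U ∂W.perturbedMeasure (fundamentalRep (Fin N)) s| ≤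
      (A * (4 * Real.sqrt N) * (∑ x ∈ Δ, δ x) * Real.exp (m * (D + 1)) *
          ((Fintype.card {ij : Fin d × Fin d // ij.1 < ij.2} : ℝ) * ((1 + Real.exp (-(m / d))) / (1 - Real.exp (-(m / d)))) ^ d)) *
        |t - s| := by
  set K : ℝ := A * (4 * Real.sqrt N) * (∑ x ∈ Δ, δ x) * Real.exp (m * (D + 1)) *
    ((Fintype.card {ij : Fin d × Fin d // ij.1 < ij.2} : ℝ) * ((1 + Real.exp (-(m / d))) / (1 - Real.exp (-(m / d)))) ^ d) with hK
  -- mean value inequality on `[lo, hi]` with the derivative bound `|Cov(F, S_W)| ≤ K`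
  have hderiv : ∀ u ∈ Set.Icc lo hi, HasDerivWithinAt (fun r : ℝ => ∫ U, F U ∂W.perturbedMeasure (fundamentalRep (Fin N)) r)
      (cov[F, fun U => -wilsonAction (fundamentalRep (Fin N)) U; W.perturbedMeasure (fundamentalRep (Fin N)) u]) (Set.Icc lo hi) u :=
    fun u _ => (hasDerivAt_memberExpectation W hFm hFb u).hasDerivWithinAt
  have hbound : ∀ u ∈ Set.Icc lo hi,
      ‖cov[F, fun U => -wilsonAction (fundamentalRep (Fin N)) U; W.perturbedMeasure (fundamentalRep (Fin N)) u]‖ ≤ K := by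
    intro u hu
    rw [covariance_fun_neg_right, Real.norm_eq_abs, abs_neg]
    exact abs_cov_wilsonAction_le_of_clustersWith hd (hW u hu) hA hm hFm hFdep hFb hFlip hD
  have hmv := (convex_Icc lo hi).norm_image_sub_le_of_norm_hasDerivWithin_le hderiv hbound hs ht
  rw [Real.norm_eq_abs, Real.norm_eq_abs] at hmv
  exact hmv

/-- ★★ **ON THE BALL, UP TO `β⋆`**: `TorusClusteringOnBallUpTo N d βs ε₀ ε₁ r A m` (`A ≥ 0`, `m > 0`, `d ≥ 1`) gives C-LIP on `[0, βs]` for EVERY member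
`W ∈ ClusterDomainFR ε₀ ε₁ r` on every torus `L ≥ 3`, with one constant per observable. [folklore] -/
theorem abs_memberExpectation_sub_le_onBallUpTo (hd : 1 ≤ d) {βs ε₀ ε₁ A m : ℝ} {r : ℕ}
    (h : TorusClusteringOnBallUpTo N d βs ε₀ ε₁ r A m) (hA : 0 ≤ A) (hm : 0 < m) (hL : 3 ≤ L) {W : Perturbation d L N}
    (hWmem : W ∈ ClusterDomainFR ε₀ ε₁ r) {F : GaugeConfig d L (SUN N) → ℝ} (hFm : Measurable F)
    {Δ : Finset (Edge d L)} (hFdep : DependsOn F (↑Δ : Set (Edge d L))) {M : ℝ} (hFb : ∀ U, |F U| ≤ M) {δ : Edge d L → ℝ}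
    (hFlip : IsLipBound suFrobDist F δ) {x₀ : Literature.MathematicalPhysics.QuantumFieldTheory.Site d L} {D : ℕ}
    (hD : ∀ x ∈ Δ, torusNorm (x.1 - x₀) ≤ D) {s t : ℝ} (hs : s ∈ Set.Icc 0 βs) (ht : t ∈ Set.Icc 0 βs) :
    |∫ U, F U ∂W.perturbedMeasure (fundamentalRep (Fin N)) t - ∫ U, F U ∂W.perturbedMeasure (fundamentalRep (Fin N)) s| ≤
      (A * (4 * Real.sqrt N) * (∑ x ∈ Δ, δ x) * Real.exp (m * (D + 1)) *
          ((Fintype.card {ij : Fin d × Fin d // ij.1 < ij.2} : ℝ) * ((1 + Real.exp (-(m / d))) / (1 - Real.exp (-(m / d)))) ^ d)) *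
        |t - s| :=
  abs_memberExpectation_sub_le hd hA hm (fun u hu => h u hu.1 hu.2 L hL W hWmem) hFm hFdep hFb hFlip hD hs ht

end EnergyVariance

end Summit.Ventures.YMGap.RobustBall
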